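import Literature.Computability.AlgebraicComplexity.AsymptoticSpectrum
import Literature.Computability.AlgebraicComplexity.BorderRankCW
import HarnessLib

/-!
# Kronecker powers of `T_{cw,2}` have trivial centroid

For a 3-tensor `t ∈ A ⊗ B ⊗ C` the **centroid** is the algebra of triples `(X, Y, Z)` of
endomorphisms of `A`, `B`, `C` with `(X⊗1⊗1)t = (1⊗Y⊗1)t = (1⊗1⊗Z)t`.  It is the endomorphism
algebra of `t` for the block-sum (`⊕`) structure: `t` is `⊕`-indecomposable iff its centroid has
no idempotents other than `0, 1`, and when the centroid of every summand is *commutative* local,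
block-sum decompositions are unique up to isomorphism (Krull–Schmidt), so that `⊕`-cancellation
holds in that class.

**Theorem** (`centroid_kroneckerPow_cwTensor_two`).  For every `N` and every commutative semiring
`K`, the centroid of the Kronecker power `T_{cw,2}^{⊠N} ∈ (K^{3^N})^{⊗3}` (coordinates
`Fin N → Fin 3`, Coppersmith–Winograd basis, `kroneckerPow (cwTensor K 2) N`) is `K · (1,1,1)`:
if matrices `X, Y, Z` satisfy `∑_{a'} X_{a a'} T_{a' b c} = ∑_{b'} Y_{b b'} T_{a b' c} =
∑_{c'} Z_{c c'} T_{a b c'}` for all `a b c`, then `X = Y = Z = x · 1` for one scalar `x`.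

In particular every `T_{cw,2}^{⊠N}` is `⊕`-indecomposable with scalar (hence commutative, local
over a field) centroid — the input that makes Krull–Schmidt / `⊕`-cancellation available for block
sums of Kronecker powers of `T_{cw,2}`, unit tensors and matrix multiplication tensors, and hence
the algebraic half of the statement that no *finite* family of degeneration identities among such
block sums certifies `R̃(T_{cw,2}) = 3` (the other half is an orbit-closure rigidity theorem from
geometric invariant theory, not formalised here).

*Proof.*  Purely combinatorial, valid over any commutative semiring.  The support of
`T_{cw,2}^{⊠N}` is `S^N`, `S = {(0,j,j), (j,0,j), (j,j,0) : j = 1,2}`; a pair of legs determines the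
third (`cwFill`), so each of the three sums collapses to a single matrix entry or to `0`
(`sum_leg₁₋₃`).  Off-diagonal entries vanish because for `a ≠ a'` there are `b, c` completing to
`a'` but not completable with `a` (`cwWitB`, `cwWitC`); diagonal entries agree along the support,
and any two first legs have a common completable partner (`cwMeet`), so all diagonal entries are
one scalar (`centroid_core`).  The one-coordinate facts are closed Boolean computations on `Fin 3`.

## References
* V. Strassen, *Relative bilinear complexity and matrix multiplication*, J. reine angew. Math.
  375/376 (1987) — degeneration calculus, block sums.
* P. Bürgisser, M. Clausen, M. A. Shokrollahi, *Algebraic Complexity Theory*, Springer 1997, §14–15.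
* D. Coppersmith, S. Winograd, J. Symb. Comput. 9 (1990), §6 (the tensor `T_{cw,q}`).
-/

namespace Summit.MatrixMultiplication.MatrixMultiplication.Theorems

open Finset Literature.Computability.AlgebraicComplexity

section CwCentroid

variable {K : Type*} [CommSemiring K] {N : ℕ}

/-! ### One-coordinate tables on `Fin 3` (Coppersmith–Winograd basis `x₀, x₁, x₂`) -/

/-- Support test of `T_{cw,2}` in one coordinate: `{(0,j,j), (j,0,j), (j,j,0) : j ≠ 0}`. -/
def cwSupp (x y z : Fin 3) : Bool :=
  decide ((x = 0 ∧ y = z ∧ y ≠ 0) ∨ (y = 0 ∧ x = z ∧ x ≠ 0) ∨ (z = 0 ∧ x = y ∧ x ≠ 0))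

/-- Completable pairs: `(x, y)` extends to a support triple iff it is `(0,j)`, `(j,0)` or `(j,j)`
with `j ≠ 0`. -/
def cwPair (x y : Fin 3) : Bool :=
  decide ((x = 0 ∧ y ≠ 0) ∨ (x ≠ 0 ∧ y = 0) ∨ (x ≠ 0 ∧ x = y))

/-- The unique completion of a completable pair (junk value `0` otherwise). -/
def cwFill (x y : Fin 3) : Fin 3 := if x = 0 then y else if y = 0 then x else 0

/-- Second leg of a witness pair for `(x, x')`: together with `cwWitC x x'` it completes to `x'`,
while `(x, cwWitC x x')` is not completable when `x ≠ x'`. -/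
def cwWitB (x x' : Fin 3) : Fin 3 :=
  if x = x' then (if x' = 0 then 1 else 0)
  else if x = 0 then x' else if x' = 0 then (if x = 1 then 2 else 1) else 0

/-- Third leg of the witness pair for `(x, x')`, see `cwWitB`. -/
def cwWitC (x x' : Fin 3) : Fin 3 :=
  if x = x' then (if x' = 0 then 1 else x')
  else if x = 0 then 0 else if x' = 0 then (if x = 1 then 2 else 1) else x'

/-- A common completable partner of `x` and `x'`. -/
def cwMeet (x x' : Fin 3) : Fin 3 :=
  if x = 0 then (if x' = 0 then 1 else x') else (if x' = 0 then x else 0)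

/-- Some completable partner of `y` (on the left). -/
def cwMate (y : Fin 3) : Fin 3 := if y = 0 then 1 else 0

/-- Support triples with prescribed legs 2, 3: leg 1 is the completion. -/
theorem cwSupp_iff₁ : ∀ x y z : Fin 3, cwSupp z x y = true ↔ (cwPair x y = true ∧ z = cwFill x y) := by
  decide

/-- Support triples with prescribed legs 1, 3: leg 2 is the completion. -/
theorem cwSupp_iff₂ : ∀ x y z : Fin 3, cwSupp x z y = true ↔ (cwPair x y = true ∧ z = cwFill x y) := by
  decide

/-- Support triples with prescribed legs 1, 2: leg 3 is the completion. -/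
theorem cwSupp_iff₃ : ∀ x y z : Fin 3, cwSupp x y z = true ↔ (cwPair x y = true ∧ z = cwFill x y) := by
  decide

/-- Completability is symmetric. -/
theorem cwPair_comm : ∀ x y : Fin 3, cwPair x y = cwPair y x := by decide

/-- Completion is symmetric. -/
theorem cwFill_comm : ∀ x y : Fin 3, cwFill x y = cwFill y x := by decide

/-- The witness pair `(cwWitB x x', cwWitC x x')` completes to `x'`, and `(x, cwWitC x x')` is not
completable when `x ≠ x'`. -/
theorem cwWit_spec : ∀ x x' : Fin 3,
    cwPair (cwWitB x x') (cwWitC x x') = true ∧ cwFill (cwWitB x x') (cwWitC x x') = x' ∧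
      (x ≠ x' → cwPair x (cwWitC x x') = false) := by
  decide

/-- A support triple `(x, y, cwFill x y)` read from each of its three sides. -/
theorem cwFill_spec : ∀ x y : Fin 3, cwPair x y = true →
    cwPair y (cwFill x y) = true ∧ cwFill y (cwFill x y) = x ∧
      cwPair x (cwFill x y) = true ∧ cwFill x (cwFill x y) = y := by
  decide

/-- `cwMeet x x'` is completable with both `x` and `x'`. -/
theorem cwMeet_spec : ∀ x x' : Fin 3,
    cwPair x (cwMeet x x') = true ∧ cwPair x' (cwMeet x x') = true := by
  decide

/-- `cwMate y` is completable with `y`. -/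
theorem cwMate_spec : ∀ y : Fin 3, cwPair (cwMate y) y = true := by decide

/-! ### The support of `T_{cw,2}^{⊠N}` and the collapse of the three contractions -/

/-- Entries of `T_{cw,2}` through the Boolean support test. -/
theorem cwTensor_two_eq_ite_cwSupp (x y z : Fin 3) :
    cwTensor K 2 x y z = if cwSupp x y z = true then 1 else 0 := by
  by_cases h : (x = 0 ∧ y = z ∧ y ≠ 0) ∨ (y = 0 ∧ x = z ∧ x ≠ 0) ∨ (z = 0 ∧ x = y ∧ x ≠ 0)
  · have h' : cwSupp x y z = true := decide_eq_true h
    rw [cwTensor_apply, if_pos h, if_pos h']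
  · have h' : ¬ cwSupp x y z = true := fun hh => h (of_decide_eq_true hh)
    rw [cwTensor_apply, if_neg h, if_neg h']

/-- Entries of `T_{cw,2}^{⊠N}`: the indicator of the coordinatewise support. -/
theorem kroneckerPow_cwTensor_two_eq_ite_cwSupp (a b c : Fin N → Fin 3) :
    kroneckerPow (cwTensor K 2) N a b c =
      if (∀ i, cwSupp (a i) (b i) (c i) = true) then 1 else 0 := by
  rw [kroneckerPow_apply]
  by_cases h : ∀ i, cwSupp (a i) (b i) (c i) = true
  · rw [if_pos h]
    exact Finset.prod_eq_one fun i _ => by rw [cwTensor_two_eq_ite_cwSupp, if_pos (h i)]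
  · rw [if_neg h]
    push Not at h
    obtain ⟨i, hi⟩ := h
    exact Finset.prod_eq_zero (Finset.mem_univ i) (by rw [cwTensor_two_eq_ite_cwSupp, if_neg hi])

/-- A sum against an indicator supported on at most one point collapses. -/
theorem sum_mul_ite_eq_of_iff {P : Type*} [Fintype P] (f : P → K) (good : P → Prop)
    [DecidablePred good] (G : Prop) [Decidable G] (σ : P) (key : ∀ q, good q ↔ (G ∧ q = σ)) :
    ∑ q, f q * (if good q then 1 else 0) = if G then f σ else 0 := by
  by_cases hG : G
  · rw [if_pos hG, Finset.sum_eq_single_of_mem σ (Finset.mem_univ _) ?_]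
    · rw [if_pos ((key σ).2 ⟨hG, rfl⟩), mul_one]
    · intro q _ hne
      rw [if_neg (fun h => hne ((key q).1 h).2), mul_zero]
  · rw [if_neg hG]
    exact Finset.sum_eq_zero fun q _ => by rw [if_neg (fun h => hG ((key q).1 h).1), mul_zero]

/-- Contraction of a matrix into the first leg of `T_{cw,2}^{⊠N}` collapses to one entry. -/
theorem sum_leg₁ (X : (Fin N → Fin 3) → (Fin N → Fin 3) → K) (a b c : Fin N → Fin 3) :
    ∑ a', X a a' * kroneckerPow (cwTensor K 2) N a' b c =
      if (∀ i, cwPair (b i) (c i) = true) then X a (fun i => cwFill (b i) (c i)) else 0 := by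
  simp_rw [kroneckerPow_cwTensor_two_eq_ite_cwSupp]
  refine sum_mul_ite_eq_of_iff (X a) (fun a' => ∀ i, cwSupp (a' i) (b i) (c i) = true) _
    (fun i => cwFill (b i) (c i)) (fun a' => ⟨fun h => ?_, ?_⟩)
  · exact ⟨fun i => ((cwSupp_iff₁ _ _ _).1 (h i)).1, funext fun i => ((cwSupp_iff₁ _ _ _).1 (h i)).2⟩
  · rintro ⟨h, rfl⟩ i
    exact (cwSupp_iff₁ _ _ _).2 ⟨h i, rfl⟩

/-- Contraction of a matrix into the second leg of `T_{cw,2}^{⊠N}` collapses to one entry. -/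
theorem sum_leg₂ (Y : (Fin N → Fin 3) → (Fin N → Fin 3) → K) (a b c : Fin N → Fin 3) :
    ∑ b', Y b b' * kroneckerPow (cwTensor K 2) N a b' c =
      if (∀ i, cwPair (a i) (c i) = true) then Y b (fun i => cwFill (a i) (c i)) else 0 := by
  simp_rw [kroneckerPow_cwTensor_two_eq_ite_cwSupp]
  refine sum_mul_ite_eq_of_iff (Y b) (fun b' => ∀ i, cwSupp (a i) (b' i) (c i) = true) _
    (fun i => cwFill (a i) (c i)) (fun b' => ⟨fun h => ?_, ?_⟩)
  · exact ⟨fun i => ((cwSupp_iff₂ _ _ _).1 (h i)).1, funext fun i => ((cwSupp_iff₂ _ _ _).1 (h i)).2⟩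
  · rintro ⟨h, rfl⟩ i
    exact (cwSupp_iff₂ _ _ _).2 ⟨h i, rfl⟩

/-- Contraction of a matrix into the third leg of `T_{cw,2}^{⊠N}` collapses to one entry. -/
theorem sum_leg₃ (Z : (Fin N → Fin 3) → (Fin N → Fin 3) → K) (a b c : Fin N → Fin 3) :
    ∑ c', Z c c' * kroneckerPow (cwTensor K 2) N a b c' =
      if (∀ i, cwPair (a i) (b i) = true) then Z c (fun i => cwFill (a i) (b i)) else 0 := by
  simp_rw [kroneckerPow_cwTensor_two_eq_ite_cwSupp]
  refine sum_mul_ite_eq_of_iff (Z c) (fun c' => ∀ i, cwSupp (a i) (b i) (c' i) = true) _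
    (fun i => cwFill (a i) (b i)) (fun c' => ⟨fun h => ?_, ?_⟩)
  · exact ⟨fun i => ((cwSupp_iff₃ _ _ _).1 (h i)).1, funext fun i => ((cwSupp_iff₃ _ _ _).1 (h i)).2⟩
  · rintro ⟨h, rfl⟩ i
    exact (cwSupp_iff₃ _ _ _).2 ⟨h i, rfl⟩

/-! ### The combinatorial core and the theorem -/

/-- Core of the centroid computation: two matrices intertwined through the collapsed contractions
are equal scalar matrices. -/
theorem centroid_core (M M' : (Fin N → Fin 3) → (Fin N → Fin 3) → K)
    (h : ∀ p q r : Fin N → Fin 3,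
      (if (∀ i, cwPair (q i) (r i) = true) then M p (fun i => cwFill (q i) (r i)) else 0) =
        (if (∀ i, cwPair (p i) (r i) = true) then M' q (fun i => cwFill (p i) (r i)) else 0)) :
    ∃ x : K, (∀ p p', M p p' = if p = p' then x else 0) ∧
      (∀ q q', M' q q' = if q = q' then x else 0) := by
  have hv1 : ∀ p q r : Fin N → Fin 3, (∀ i, cwPair (q i) (r i) = true) →
      ¬ (∀ i, cwPair (p i) (r i) = true) → M p (fun i => cwFill (q i) (r i)) = 0 := by
    intro p q r hG hnG
    have e := h p q r
    rwa [if_pos hG, if_neg hnG] at e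
  have hv2 : ∀ p q r : Fin N → Fin 3, ¬ (∀ i, cwPair (q i) (r i) = true) →
      (∀ i, cwPair (p i) (r i) = true) → M' q (fun i => cwFill (p i) (r i)) = 0 := by
    intro p q r hnG hG
    have e := h p q r
    rw [if_neg hnG, if_pos hG] at e
    exact e.symm
  have hv3 : ∀ p q r : Fin N → Fin 3, (∀ i, cwPair (q i) (r i) = true) →
      (∀ i, cwPair (p i) (r i) = true) →
        M p (fun i => cwFill (q i) (r i)) = M' q (fun i => cwFill (p i) (r i)) := by
    intro p q r h1 h2
    have e := h p q r
    rwa [if_pos h1, if_pos h2] at e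
  -- off-diagonal entries vanish
  have offM : ∀ p p' : Fin N → Fin 3, p ≠ p' → M p p' = 0 := by
    intro p p' hne
    obtain ⟨i₀, hi₀⟩ := Function.ne_iff.mp hne
    have e := hv1 p (fun i => cwWitB (p i) (p' i)) (fun i => cwWitC (p i) (p' i))
      (fun i => (cwWit_spec (p i) (p' i)).1)
      (fun hh => ne_true_of_eq_false ((cwWit_spec (p i₀) (p' i₀)).2.2 hi₀) (hh i₀))
    have hσ : (fun i => cwFill (cwWitB (p i) (p' i)) (cwWitC (p i) (p' i))) = p' :=
      funext fun i => (cwWit_spec (p i) (p' i)).2.1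
    rwa [hσ] at e
  have offM' : ∀ q q' : Fin N → Fin 3, q ≠ q' → M' q q' = 0 := by
    intro q q' hne
    obtain ⟨i₀, hi₀⟩ := Function.ne_iff.mp hne
    have e := hv2 (fun i => cwWitB (q i) (q' i)) q (fun i => cwWitC (q i) (q' i))
      (fun hh => ne_true_of_eq_false ((cwWit_spec (q i₀) (q' i₀)).2.2 hi₀) (hh i₀))
      (fun i => (cwWit_spec (q i) (q' i)).1)
    have hσ : (fun i => cwFill (cwWitB (q i) (q' i)) (cwWitC (q i) (q' i))) = q' :=
      funext fun i => (cwWit_spec (q i) (q' i)).2.1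
    rwa [hσ] at e
  -- diagonal entries agree along completable pairs
  have link : ∀ p q : Fin N → Fin 3, (∀ i, cwPair (p i) (q i) = true) → M p p = M' q q := by
    intro p q hpq
    have e := hv3 p q (fun i => cwFill (p i) (q i))
      (fun i => (cwFill_spec (p i) (q i) (hpq i)).1)
      (fun i => (cwFill_spec (p i) (q i) (hpq i)).2.2.1)
    have h1 : (fun i => cwFill (q i) (cwFill (p i) (q i))) = p :=
      funext fun i => (cwFill_spec (p i) (q i) (hpq i)).2.1
    have h2 : (fun i => cwFill (p i) (cwFill (p i) (q i))) = q :=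
      funext fun i => (cwFill_spec (p i) (q i) (hpq i)).2.2.2
    rwa [h1, h2] at e
  have allM : ∀ p p' : Fin N → Fin 3, M p p = M p' p' := by
    intro p p'
    rw [link p (fun i => cwMeet (p i) (p' i)) (fun i => (cwMeet_spec (p i) (p' i)).1),
      link p' (fun i => cwMeet (p i) (p' i)) (fun i => (cwMeet_spec (p i) (p' i)).2)]
  have diagM' : ∀ q : Fin N → Fin 3, M' q q = M (fun i => cwMate (q i)) (fun i => cwMate (q i)) :=
    fun q => (link _ q (fun i => cwMate_spec (q i))).symm
  refine ⟨M (fun _ => 0) (fun _ => 0), fun p p' => ?_, fun q q' => ?_⟩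
  · by_cases hp : p = p'
    · subst hp
      rw [if_pos rfl]
      exact allM _ _
    · rw [if_neg hp]
      exact offM _ _ hp
  · by_cases hq : q = q'
    · subst hq
      rw [if_pos rfl, diagM' q]
      exact allM _ _
    · rw [if_neg hq]
      exact offM' _ _ hq

/-- **Kronecker powers of `T_{cw,2}` have trivial centroid.**  If matrices `X, Y, Z` on
`K^{3^N}` satisfy `(X⊗1⊗1)T = (1⊗Y⊗1)T = (1⊗1⊗Z)T` for `T = T_{cw,2}^{⊠N}`
(`kroneckerPow (cwTensor K 2) N`, Coppersmith–Winograd basis), then `X = Y = Z = x·1` for a single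
scalar `x`.  Hence `T_{cw,2}^{⊠N}` is `⊕`-indecomposable with commutative (scalar) centroid, for
every `N` and every commutative semiring `K`. [new] -/
theorem centroid_kroneckerPow_cwTensor_two (X Y Z : (Fin N → Fin 3) → (Fin N → Fin 3) → K)
    (hXY : ∀ a b c : Fin N → Fin 3,
      ∑ a', X a a' * kroneckerPow (cwTensor K 2) N a' b c =
        ∑ b', Y b b' * kroneckerPow (cwTensor K 2) N a b' c)
    (hYZ : ∀ a b c : Fin N → Fin 3,
      ∑ b', Y b b' * kroneckerPow (cwTensor K 2) N a b' c =
        ∑ c', Z c c' * kroneckerPow (cwTensor K 2) N a b c') :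
    ∃ x : K, (∀ a a', X a a' = if a = a' then x else 0) ∧
      (∀ b b', Y b b' = if b = b' then x else 0) ∧ (∀ c c', Z c c' = if c = c' then x else 0) := by
  obtain ⟨x, hX, hY⟩ := centroid_core X Y (fun p q r => by
    have e := hXY p q r
    rw [sum_leg₁, sum_leg₂] at e
    exact e)
  obtain ⟨y, hY', hZ⟩ := centroid_core Y Z (fun p q r => by
    have e := hYZ r p q
    rw [sum_leg₂, sum_leg₃] at e
    have s1 : (fun i => cwFill (r i) (q i)) = fun i => cwFill (q i) (r i) :=
      funext fun i => cwFill_comm _ _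
    have s2 : (fun i => cwFill (r i) (p i)) = fun i => cwFill (p i) (r i) :=
      funext fun i => cwFill_comm _ _
    have s3 : (∀ i, cwPair (r i) (q i) = true) ↔ ∀ i, cwPair (q i) (r i) = true :=
      forall_congr' fun i => by rw [cwPair_comm]
    have s4 : (∀ i, cwPair (r i) (p i) = true) ↔ ∀ i, cwPair (p i) (r i) = true :=
      forall_congr' fun i => by rw [cwPair_comm]
    rw [s1, s2, if_congr s3 rfl rfl, if_congr s4 rfl rfl] at e
    exact e)
  have hxy : x = y := by
    have e1 := hY (fun _ => 0) (fun _ => 0)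
    have e2 := hY' (fun _ => 0) (fun _ => 0)
    rw [if_pos rfl] at e1 e2
    rw [← e1, ← e2]
  subst hxy
  exact ⟨x, hX, hY, hZ⟩

end CwCentroid

end Summit.MatrixMultiplication.MatrixMultiplication.Theorems
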